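/-
Copyright (c) 2026 the pub-hodgecm-mathlib formalisation cell (harness21).  Prover seat hodgecm-mathlib-K2E3-p23 (g4), Track B «K2-LIT» ∕ h413
(`stmt-HodgeConjecture-24833`), line `K2_E3_EllipticInputs`, row 11 split road, road «FC-GL» (line lead K2E3-p23 (g4); deal D58), brick (GL-1).  2026-09-04.
-/
import Summits.HodgeConjecture.HodgeConjecture.Theorems.K2E3GL3ModCentre             -- ★ (GL-P) p857483 (this seat): `Ḡ` frame, scalars, compactness criterion, Cartan cover
import HarnessLib

/-!
# Crux `H413` — K2-LIT E3, row 11 SPLIT road, road «FC-GL», brick (GL-1): NORMALISED LIFTS AND THE BOX ESTIMATES ON `GL₃(F)` — entries, determinant and the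
# BLOCK LOWER BOUNDS for the two near-parabolic shapes

Cell `hodgecm-mathlib`, Track B, line `K2_E3_EllipticInputs`, socket U12 row 11 (11-3-split) via road «FC-GL» (deal D58; census `CENSUS-SD-GL3Supercuspidal.K2E3-p23-g4.md`,
RULINGS #1∕#2); seat K2E3-p23 (g4).  THEOREMS ONLY; count-neutral helper (`--supports stmt-HodgeConjecture-24833 --as helper`).

THE MATHEMATICS (matrix algebra over a `ℤᵐ⁰`-valued field; no measure theory).
* §1 `exists_normalized_lift` — every class in `Ḡ = GL₃(F) ⧸ Z` has a lift `h` with ALL entries of valuation `≤ 1` and ONE entry of valuation `= 1` (scale by `ϖᵐ·1`).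
* §2 `v_det_le_of_entries_le` (`v(det y) ≤ exp(3M)`), `exists_entry_one_le_of_one_le_v_det` (`1 ≤ v(det y) ⇒` some entry has `v ≥ 1`),
  `inv_entries_le_of_scaleBound` ∕ `v_det_ge_of_scaleBound` — from the SCALE-INVARIANT bound `v(y i j)·v(y⁻¹ i' j') ≤ exp 2N` of ★ GL-P's compactness criterion at a
  normalised lift: `v(h⁻¹ i j) ≤ exp 2N`, `exp(−6N) ≤ v(det h)`; `conj_entries_le_of_scaleBound` — for `y = t h t⁻¹` (any lift of a box point, `v(det y⁻¹) ≥ 1`):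
  ALL entries of `y` are `≤ exp 2N`.
* §3 **BLOCK LOWER BOUNDS**: SHAPE I (`v(h₀₁), v(h₀₂) ≤ exp(M − d)`, `3M + M' < d`): `v(h₀₀ · det B) = v(det h)` and `exp(−(M' + 2M)) ≤ v(h₀₀)` (`B` = block `{1,2}`);
  SHAPE II (`v(h₀₂), v(h₁₂) ≤ exp(M − d)`): `exp(−(M' + 2M)) ≤ v(h₂₂)`.
* §4 `coe_torusRow_mul_apply`, **`blockQuadI_torusRow_mul`** ∕ `blockQuadII_torusRow_mul` — left multiplication by `diag(u,1,1)` (resp. `diag(1,1,u)`) scales row `0`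
  (resp. `2`) and turns the block quadratic `Q_I(h) = (h₀₀ − h₁₁)(h₀₀ − h₂₂) − h₁₂h₂₁` into the MONIC QUADRATIC `(u h₀₀)² + c (u h₀₀) + e`, `c = −(h₁₁ + h₂₂)`,
  `e = h₁₁h₂₂ − h₁₂h₂₁` (the input shape of ★ GL-D2 `unitsQuadraticFibre`).

HONEST LABEL: HC_CM is proved only modulo the 7 printed citations (2 remaining named inputs: hLiu418 = stmt-HodgeConjecture-24832, h413 =
stmt-HodgeConjecture-24833) until rung 0 closes; elementary, closes no organ by itself.

## References
* [HarishChandra1970] Harish-Chandra (notes by G. van Dijk), *Harmonic Analysis on Reductive p-adic Groups*, LNM 162 (1970), Part VII §2 (near-singular boxes).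
* [BruhatTits1972] F. Bruhat, J. Tits, *Groupes réductifs sur un corps local I*, Publ. Math. IHÉS 41 (1972), (4.4.3).
* [Serre1979] J.-P. Serre, *Local Fields*, GTM 67 (1979), Ch. II §1 (ultrametric inequality).
-/

set_option autoImplicit false
-- the mandated namespace repeats `HodgeConjecture.HodgeConjecture`, as in every `Theorems/*.lean` of this sub-problem
set_option linter.dupNamespace false

noncomputable section

open Set ValuativeRel Matrix
open scoped MatrixGroups Pointwise WithZero Valued

namespace Summit.HodgeConjecture.HodgeConjecture.Cruxes.H413.K2E3GL3FinConjBoxes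

open Literature.NumberTheory.Automorphic K2E3GL3ModCentre

variable {F : Type*} [Field F] [Valued F ℤᵐ⁰]

/-! ## §1 Normalised lifts -/

/-- **NORMALISED LIFTS**: every class of `GL₃(F) ⧸ Z` has a representative all of whose entries have valuation `≤ 1`, one of them `= 1` (scale any representative by
the central `ϖᵐ·1`, `exp m =` the largest entry valuation). [cite: BruhatTits1972, (4.4.3)] -/
theorem exists_normalized_lift {ϖ : F} (hϖ : Valued.v ϖ = WithZero.exp (-1 : ℤ)) (hϖ0 : ϖ ≠ 0) (x : GL (Fin 3) F ⧸ Subgroup.center (GL (Fin 3) F)) :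
    ∃ h : GL (Fin 3) F, (QuotientGroup.mk h : GL (Fin 3) F ⧸ Subgroup.center (GL (Fin 3) F)) = x ∧
      (∀ i j, Valued.v ((h : Matrix (Fin 3) (Fin 3) F) i j) ≤ 1) ∧ ∃ i j, Valued.v ((h : Matrix (Fin 3) (Fin 3) F) i j) = 1 := by
  induction x using QuotientGroup.induction_on with
  | H g =>
    obtain ⟨p, -, hp⟩ := Finset.exists_max_image Finset.univ (fun p : Fin 3 × Fin 3 => Valued.v ((g : Matrix (Fin 3) (Fin 3) F) p.1 p.2)) Finset.univ_nonempty
    -- the maximal entry is non-zero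
    have hne : Valued.v ((g : Matrix (Fin 3) (Fin 3) F) p.1 p.2) ≠ 0 := by
      intro h0
      have hzero : (g : Matrix (Fin 3) (Fin 3) F) = 0 := by
        ext i j
        have := hp (i, j) (Finset.mem_univ _)
        rw [h0, le_zero_iff, Valuation.zero_iff] at this
        exact this
      exact Matrix.GeneralLinearGroup.det_ne_zero g (by rw [hzero]; exact Matrix.det_zero)
    -- scale by `ϖᵐ · 1`, `exp m = v(g_p)`
    set m : ℤ := WithZero.log (Valued.v ((g : Matrix (Fin 3) (Fin 3) F) p.1 p.2)) with hm
    have hexp : WithZero.exp m = Valued.v ((g : Matrix (Fin 3) (Fin 3) F) p.1 p.2) := by rw [hm, WithZero.exp_log hne]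
    have hvϖm : Valued.v (ϖ ^ m) = WithZero.exp (-m) := by
      rw [map_zpow₀, hϖ, ← WithZero.exp_zsmul, smul_eq_mul, mul_neg_one]
    refine ⟨zpowDiagGL (n := 3) hϖ0 (fun _ => m) * g, ?_, fun i j => ?_, ⟨p.1, p.2, ?_⟩⟩
    · rw [QuotientGroup.mk_mul, mk_zpowDiagGL_const_eq_one, one_mul]
    · rw [zpowDiagGL_const_mul_apply, map_mul, hvϖm]
      calc WithZero.exp (-m) * Valued.v ((g : Matrix (Fin 3) (Fin 3) F) i j) ≤ WithZero.exp (-m) * WithZero.exp m :=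
            mul_le_mul' le_rfl (hexp ▸ hp (i, j) (Finset.mem_univ _))
        _ = 1 := by rw [← WithZero.exp_add, neg_add_cancel, WithZero.exp_zero]
    · rw [zpowDiagGL_const_mul_apply, map_mul, hvϖm, ← hexp, ← WithZero.exp_add, neg_add_cancel, WithZero.exp_zero]

/-! ## §2 Determinants and the scale-invariant bound -/

/-- Entries `≤ exp M` ⇒ `v(det y) ≤ exp(3M)` (six triple products, ultrametric). [cite: Serre1979, Ch. II §1] -/
theorem v_det_le_of_entries_le {M : ℤ} (A : Matrix (Fin 3) (Fin 3) F) (hA : ∀ i j, Valued.v (A i j) ≤ WithZero.exp M) :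
    Valued.v A.det ≤ WithZero.exp (3 * M) := by
  have h3 : ∀ a b c : F, Valued.v a ≤ WithZero.exp M → Valued.v b ≤ WithZero.exp M → Valued.v c ≤ WithZero.exp M →
      Valued.v (a * b * c) ≤ WithZero.exp (3 * M) := by
    intro a b c ha hb hc
    rw [map_mul, map_mul, show (3 : ℤ) * M = M + M + M by ring, WithZero.exp_add, WithZero.exp_add]
    exact mul_le_mul' (mul_le_mul' ha hb) hc
  rw [Matrix.det_fin_three]
  refine Valuation.map_sub_le _ (Valuation.map_add_le _ (Valuation.map_add_le _ (Valuation.map_sub_le _ (Valuation.map_sub_le _ ?_ ?_) ?_) ?_) ?_) ?_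
  all_goals exact h3 _ _ _ (hA _ _) (hA _ _) (hA _ _)

/-- If `1 ≤ v(det y)` then some entry of `y` has valuation `≥ 1` (else every triple product is `< 1`). [cite: Serre1979, Ch. II §1] -/
theorem exists_entry_one_le_of_one_le_v_det (A : Matrix (Fin 3) (Fin 3) F) (hA : 1 ≤ Valued.v A.det) : ∃ i j, 1 ≤ Valued.v (A i j) := by
  by_contra hcon
  simp only [not_exists, not_le] at hcon
  have h3 : ∀ a b c : F, Valued.v a < 1 → Valued.v b < 1 → Valued.v c < 1 → Valued.v (a * b * c) < 1 := by
    intro a b c ha hb hc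
    rw [map_mul, map_mul]
    calc Valued.v a * Valued.v b * Valued.v c ≤ Valued.v a * 1 * 1 := mul_le_mul' (mul_le_mul' le_rfl hb.le) hc.le
      _ = Valued.v a := by rw [mul_one, mul_one]
      _ < 1 := ha
  have hlt : Valued.v A.det < 1 := by
    rw [Matrix.det_fin_three]
    refine Valuation.map_sub_lt _ (Valuation.map_add_lt _ (Valuation.map_add_lt _ (Valuation.map_sub_lt _ (Valuation.map_sub_lt _ ?_ ?_) ?_) ?_) ?_) ?_
    all_goals exact h3 _ _ _ (hcon _ _) (hcon _ _) (hcon _ _)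
  exact absurd hA (not_le.2 hlt)

/-- From the scale-invariant bound at a NORMALISED element: all entries of `h⁻¹` are `≤ exp 2N`. [folklore] -/
theorem inv_entries_le_of_scaleBound {N : ℕ} (h : GL (Fin 3) F)
    (hb : ∀ i j i' j', Valued.v ((h : Matrix (Fin 3) (Fin 3) F) i j) * Valued.v (((h⁻¹ : GL (Fin 3) F) : Matrix (Fin 3) (Fin 3) F) i' j') ≤ WithZero.exp (2 * (N : ℤ)))
    (hone : ∃ i j, Valued.v ((h : Matrix (Fin 3) (Fin 3) F) i j) = 1) (i' j' : Fin 3) :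
    Valued.v (((h⁻¹ : GL (Fin 3) F) : Matrix (Fin 3) (Fin 3) F) i' j') ≤ WithZero.exp (2 * (N : ℤ)) := by
  obtain ⟨i, j, hij⟩ := hone
  have := hb i j i' j'
  rwa [hij, one_mul] at this

/-- From the scale-invariant bound at a normalised element: `exp(−6N) ≤ v(det h)`. [folklore] -/
theorem v_det_ge_of_scaleBound {N : ℕ} (h : GL (Fin 3) F)
    (hb : ∀ i j i' j', Valued.v ((h : Matrix (Fin 3) (Fin 3) F) i j) * Valued.v (((h⁻¹ : GL (Fin 3) F) : Matrix (Fin 3) (Fin 3) F) i' j') ≤ WithZero.exp (2 * (N : ℤ)))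
    (hone : ∃ i j, Valued.v ((h : Matrix (Fin 3) (Fin 3) F) i j) = 1) :
    WithZero.exp (-(6 * (N : ℤ))) ≤ Valued.v (h : Matrix (Fin 3) (Fin 3) F).det := by
  have hinv := v_det_le_of_entries_le (((h⁻¹ : GL (Fin 3) F) : Matrix (Fin 3) (Fin 3) F)) (inv_entries_le_of_scaleBound h hb hone)
  have hdet : (((h⁻¹ : GL (Fin 3) F) : Matrix (Fin 3) (Fin 3) F)).det = ((h : Matrix (Fin 3) (Fin 3) F).det)⁻¹ := by
    rw [Matrix.coe_units_inv, Matrix.det_nonsing_inv, Ring.inverse_eq_inv']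
  rw [hdet, map_inv₀, show (3 : ℤ) * (2 * (N : ℤ)) = 6 * N by ring] at hinv
  have h0 : Valued.v (h : Matrix (Fin 3) (Fin 3) F).det ≠ 0 := (Valuation.ne_zero_iff _).2 (Matrix.GeneralLinearGroup.det_ne_zero h)
  rw [WithZero.exp_neg]
  exact (inv_le_comm₀ (zero_lt_iff.2 h0) WithZero.exp_pos).1 hinv

/-- **ALL ENTRIES OF `t h t⁻¹` ARE `≤ exp 2N`** when `y = t h t⁻¹` satisfies the scale-invariant bound and `1 ≤ v(det y⁻¹)` (so some entry of `y⁻¹` has `v ≥ 1`).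
[cite: HarishChandra1970, Part VII §2] -/
theorem entries_le_of_scaleBound_of_one_le_v_det_inv {N : ℕ} (y : GL (Fin 3) F)
    (hb : ∀ i j i' j', Valued.v ((y : Matrix (Fin 3) (Fin 3) F) i j) * Valued.v (((y⁻¹ : GL (Fin 3) F) : Matrix (Fin 3) (Fin 3) F) i' j') ≤ WithZero.exp (2 * (N : ℤ)))
    (hdet : 1 ≤ Valued.v (((y⁻¹ : GL (Fin 3) F) : Matrix (Fin 3) (Fin 3) F)).det) (i j : Fin 3) :
    Valued.v ((y : Matrix (Fin 3) (Fin 3) F) i j) ≤ WithZero.exp (2 * (N : ℤ)) := by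
  obtain ⟨i', j', h1⟩ := exists_entry_one_le_of_one_le_v_det _ hdet
  calc Valued.v ((y : Matrix (Fin 3) (Fin 3) F) i j) = Valued.v ((y : Matrix (Fin 3) (Fin 3) F) i j) * 1 := (mul_one _).symm
    _ ≤ Valued.v ((y : Matrix (Fin 3) (Fin 3) F) i j) * Valued.v (((y⁻¹ : GL (Fin 3) F) : Matrix (Fin 3) (Fin 3) F) i' j') := mul_le_mul' le_rfl h1
    _ ≤ WithZero.exp (2 * (N : ℤ)) := hb i j i' j'

/-- `v(det (t h t⁻¹)⁻¹) = v(det h)⁻¹ ≥ 1` when all entries of `h` are `≤ 1`. [folklore] -/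
theorem one_le_v_det_conj_inv (t h : GL (Fin 3) F) (hh : ∀ i j, Valued.v ((h : Matrix (Fin 3) (Fin 3) F) i j) ≤ 1) :
    1 ≤ Valued.v ((((t * h * t⁻¹)⁻¹ : GL (Fin 3) F)) : Matrix (Fin 3) (Fin 3) F).det := by
  have hle : Valued.v (h : Matrix (Fin 3) (Fin 3) F).det ≤ 1 := by
    have := v_det_le_of_entries_le (M := 0) (h : Matrix (Fin 3) (Fin 3) F) (fun i j => by rw [WithZero.exp_zero]; exact hh i j)
    rwa [mul_zero, WithZero.exp_zero] at this
  have h0 : Valued.v (h : Matrix (Fin 3) (Fin 3) F).det ≠ 0 := (Valuation.ne_zero_iff _).2 (Matrix.GeneralLinearGroup.det_ne_zero h)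
  have hdet : ((((t * h * t⁻¹)⁻¹ : GL (Fin 3) F)) : Matrix (Fin 3) (Fin 3) F).det = ((h : Matrix (Fin 3) (Fin 3) F).det)⁻¹ := by
    rw [Matrix.coe_units_inv, Matrix.det_nonsing_inv, Ring.inverse_eq_inv', Units.val_mul, Units.val_mul, Matrix.det_mul, Matrix.det_mul,
      Matrix.coe_units_inv, Matrix.det_nonsing_inv, Ring.inverse_eq_inv']
    have ht0 : (t : Matrix (Fin 3) (Fin 3) F).det ≠ 0 := Matrix.GeneralLinearGroup.det_ne_zero t
    field_simp
  rw [hdet, map_inv₀]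
  exact one_le_inv_iff₀.2 ⟨zero_lt_iff.2 h0, hle⟩

/-! ## §3 Block lower bounds for the two near-parabolic shapes -/

/-- **SHAPE I**: if `v(hᵢⱼ) ≤ exp M` for all entries, `v(h₀₁), v(h₀₂) ≤ exp(M − d)`, `exp(−M') ≤ v(det h)` and `3M + M' < d`, then
`exp(−(M' + 2M)) ≤ v(h₀₀)` (expand `det` along row `0`: the two terms through `h₀₁, h₀₂` are `< v(det h)`, so `v(h₀₀ · det B) = v(det h)` and `v(det B) ≤ exp 2M`).
[cite: HarishChandra1970, Part VII §2] -/
theorem v_diag_ge_shapeI {M M' d : ℕ} (hd : 3 * M + M' < d) (h : GL (Fin 3) F)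
    (hall : ∀ i j, Valued.v ((h : Matrix (Fin 3) (Fin 3) F) i j) ≤ WithZero.exp (M : ℤ))
    (h01 : Valued.v ((h : Matrix (Fin 3) (Fin 3) F) 0 1) ≤ WithZero.exp ((M : ℤ) - d))
    (h02 : Valued.v ((h : Matrix (Fin 3) (Fin 3) F) 0 2) ≤ WithZero.exp ((M : ℤ) - d))
    (hdet : WithZero.exp (-(M' : ℤ)) ≤ Valued.v (h : Matrix (Fin 3) (Fin 3) F).det) :
    WithZero.exp (-((M' : ℤ) + 2 * M)) ≤ Valued.v ((h : Matrix (Fin 3) (Fin 3) F) 0 0) := by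
  set A : Matrix (Fin 3) (Fin 3) F := (h : Matrix (Fin 3) (Fin 3) F) with hA
  -- `det A = A₀₀ · P + R` with `R` the terms through `A₀₁, A₀₂`
  set P : F := A 1 1 * A 2 2 - A 1 2 * A 2 1 with hP
  set R : F := -(A 0 1 * (A 1 0 * A 2 2)) + A 0 1 * (A 1 2 * A 2 0) + A 0 2 * (A 1 0 * A 2 1) + -(A 0 2 * (A 1 1 * A 2 0)) with hR
  have hdetA : A.det = A 0 0 * P + R := by rw [Matrix.det_fin_three, hP, hR]; ring
  have hP2 : Valued.v P ≤ WithZero.exp (2 * (M : ℤ)) := by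
    rw [hP, two_mul, WithZero.exp_add]
    exact Valuation.map_sub_le _ (by rw [map_mul]; exact mul_le_mul' (hall 1 1) (hall 2 2)) (by rw [map_mul]; exact mul_le_mul' (hall 1 2) (hall 2 1))
  have hlt : (3 * (M : ℤ) - d) < -(M' : ℤ) := by omega
  have hsmall : ∀ (a b c : F), Valued.v a ≤ WithZero.exp ((M : ℤ) - d) → Valued.v b ≤ WithZero.exp (M : ℤ) → Valued.v c ≤ WithZero.exp (M : ℤ) →
      Valued.v (a * (b * c)) < Valued.v A.det := by
    intro a b c ha hb hc
    rw [map_mul, map_mul]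
    calc Valued.v a * (Valued.v b * Valued.v c) ≤ WithZero.exp ((M : ℤ) - d) * (WithZero.exp (M : ℤ) * WithZero.exp (M : ℤ)) := mul_le_mul' ha (mul_le_mul' hb hc)
      _ = WithZero.exp (3 * (M : ℤ) - d) := by rw [← WithZero.exp_add, ← WithZero.exp_add]; ring_nf
      _ < WithZero.exp (-(M' : ℤ)) := WithZero.exp_lt_exp.2 hlt
      _ ≤ Valued.v A.det := hdet
  have hRlt : Valued.v R < Valued.v A.det := by
    rw [hR]
    refine Valuation.map_add_lt _ (Valuation.map_add_lt _ (Valuation.map_add_lt _ ?_ ?_) ?_) ?_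
    · rw [Valuation.map_neg]; exact hsmall _ _ _ h01 (hall 1 0) (hall 2 2)
    · exact hsmall _ _ _ h01 (hall 1 2) (hall 2 0)
    · exact hsmall _ _ _ h02 (hall 1 0) (hall 2 1)
    · rw [Valuation.map_neg]; exact hsmall _ _ _ h02 (hall 1 1) (hall 2 0)
  -- hence `v(A₀₀ · P) = v(det A)`
  have hmain : Valued.v (A 0 0 * P) = Valued.v A.det := by
    have he : A 0 0 * P = A.det + -R := by rw [hdetA]; ring
    rw [he, Valuation.map_add_eq_of_lt_left]
    rw [Valuation.map_neg]; exact hRlt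
  rw [map_mul] at hmain
  -- `v(A₀₀) ≥ v(det)/exp(2M) ≥ exp(−M')/exp(2M)`
  have hP0 : Valued.v P ≠ 0 := by
    intro h0; rw [h0, mul_zero] at hmain
    have : Valued.v A.det ≠ 0 := (Valuation.ne_zero_iff _).2 (Matrix.GeneralLinearGroup.det_ne_zero h)
    exact this hmain.symm
  have key : WithZero.exp (-(M' : ℤ)) ≤ Valued.v (A 0 0) * WithZero.exp (2 * (M : ℤ)) :=
    hdet.trans (hmain ▸ mul_le_mul' le_rfl hP2)
  calc WithZero.exp (-((M' : ℤ) + 2 * M)) = WithZero.exp (-(M' : ℤ)) * WithZero.exp (-(2 * (M : ℤ))) := by rw [← WithZero.exp_add]; ring_nf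
    _ ≤ Valued.v (A 0 0) * WithZero.exp (2 * (M : ℤ)) * WithZero.exp (-(2 * (M : ℤ))) := mul_le_mul' key le_rfl
    _ = Valued.v (A 0 0) := by rw [mul_assoc, ← WithZero.exp_add, add_neg_cancel, WithZero.exp_zero, mul_one]

/-- **SHAPE II**: if `v(hᵢⱼ) ≤ exp M`, `v(h₀₂), v(h₁₂) ≤ exp(M − d)`, `exp(−M') ≤ v(det h)` and `3M + M' < d`, then `exp(−(M' + 2M)) ≤ v(h₂₂)` (expand along column `2`).
[cite: HarishChandra1970, Part VII §2] -/
theorem v_diag_ge_shapeII {M M' d : ℕ} (hd : 3 * M + M' < d) (h : GL (Fin 3) F)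
    (hall : ∀ i j, Valued.v ((h : Matrix (Fin 3) (Fin 3) F) i j) ≤ WithZero.exp (M : ℤ))
    (h02 : Valued.v ((h : Matrix (Fin 3) (Fin 3) F) 0 2) ≤ WithZero.exp ((M : ℤ) - d))
    (h12 : Valued.v ((h : Matrix (Fin 3) (Fin 3) F) 1 2) ≤ WithZero.exp ((M : ℤ) - d))
    (hdet : WithZero.exp (-(M' : ℤ)) ≤ Valued.v (h : Matrix (Fin 3) (Fin 3) F).det) :
    WithZero.exp (-((M' : ℤ) + 2 * M)) ≤ Valued.v ((h : Matrix (Fin 3) (Fin 3) F) 2 2) := by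
  set A : Matrix (Fin 3) (Fin 3) F := (h : Matrix (Fin 3) (Fin 3) F) with hA
  set P : F := A 0 0 * A 1 1 - A 0 1 * A 1 0 with hP
  set R : F := -(A 1 2 * (A 0 0 * A 2 1)) + A 1 2 * (A 0 1 * A 2 0) + A 0 2 * (A 1 0 * A 2 1) + -(A 0 2 * (A 1 1 * A 2 0)) with hR
  have hdetA : A.det = A 2 2 * P + R := by rw [Matrix.det_fin_three, hP, hR]; ring
  have hP2 : Valued.v P ≤ WithZero.exp (2 * (M : ℤ)) := by
    rw [hP, two_mul, WithZero.exp_add]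
    exact Valuation.map_sub_le _ (by rw [map_mul]; exact mul_le_mul' (hall 0 0) (hall 1 1)) (by rw [map_mul]; exact mul_le_mul' (hall 0 1) (hall 1 0))
  have hlt : (3 * (M : ℤ) - d) < -(M' : ℤ) := by omega
  have hsmall : ∀ (a b c : F), Valued.v a ≤ WithZero.exp ((M : ℤ) - d) → Valued.v b ≤ WithZero.exp (M : ℤ) → Valued.v c ≤ WithZero.exp (M : ℤ) →
      Valued.v (a * (b * c)) < Valued.v A.det := by
    intro a b c ha hb hc
    rw [map_mul, map_mul]
    calc Valued.v a * (Valued.v b * Valued.v c) ≤ WithZero.exp ((M : ℤ) - d) * (WithZero.exp (M : ℤ) * WithZero.exp (M : ℤ)) := mul_le_mul' ha (mul_le_mul' hb hc)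
      _ = WithZero.exp (3 * (M : ℤ) - d) := by rw [← WithZero.exp_add, ← WithZero.exp_add]; ring_nf
      _ < WithZero.exp (-(M' : ℤ)) := WithZero.exp_lt_exp.2 hlt
      _ ≤ Valued.v A.det := hdet
  have hRlt : Valued.v R < Valued.v A.det := by
    rw [hR]
    refine Valuation.map_add_lt _ (Valuation.map_add_lt _ (Valuation.map_add_lt _ ?_ ?_) ?_) ?_
    · rw [Valuation.map_neg]; exact hsmall _ _ _ h12 (hall 0 0) (hall 2 1)
    · exact hsmall _ _ _ h12 (hall 0 1) (hall 2 0)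
    · exact hsmall _ _ _ h02 (hall 1 0) (hall 2 1)
    · rw [Valuation.map_neg]; exact hsmall _ _ _ h02 (hall 1 1) (hall 2 0)
  have hmain : Valued.v (A 2 2 * P) = Valued.v A.det := by
    have he : A 2 2 * P = A.det + -R := by rw [hdetA]; ring
    rw [he, Valuation.map_add_eq_of_lt_left]
    rw [Valuation.map_neg]; exact hRlt
  rw [map_mul] at hmain
  have key : WithZero.exp (-(M' : ℤ)) ≤ Valued.v (A 2 2) * WithZero.exp (2 * (M : ℤ)) :=
    hdet.trans (hmain ▸ mul_le_mul' le_rfl hP2)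
  calc WithZero.exp (-((M' : ℤ) + 2 * M)) = WithZero.exp (-(M' : ℤ)) * WithZero.exp (-(2 * (M : ℤ))) := by rw [← WithZero.exp_add]; ring_nf
    _ ≤ Valued.v (A 2 2) * WithZero.exp (2 * (M : ℤ)) * WithZero.exp (-(2 * (M : ℤ))) := mul_le_mul' key le_rfl
    _ = Valued.v (A 2 2) := by rw [mul_assoc, ← WithZero.exp_add, add_neg_cancel, WithZero.exp_zero, mul_one]

/-! ## §4 The torus moves one row; the block quadratic becomes a monic quadratic in `u · hᵢᵢ` -/

omit [Valued F ℤᵐ⁰] in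
/-- Left multiplication by `diag(d)` scales the rows: `(diag(d) · h)ᵢⱼ = dᵢ hᵢⱼ`. [folklore] -/
theorem coe_diagonalGL_mul_apply (d : Fin 3 → Fˣ) (h : GL (Fin 3) F) (i j : Fin 3) :
    ((diagonalGL (Fin 3) F d * h : GL (Fin 3) F) : Matrix (Fin 3) (Fin 3) F) i j = (d i : F) * (h : Matrix (Fin 3) (Fin 3) F) i j := by
  rw [Units.val_mul, coe_diagonalGL, Matrix.diagonal_mul]

omit [Valued F ℤᵐ⁰] in
/-- **SHAPE I: `Q_I(diag(u,1,1)·h) = (u h₀₀)² + c (u h₀₀) + e`** with `c = −(h₁₁ + h₂₂)`, `e = h₁₁h₂₂ − h₁₂h₂₁`, where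
`Q_I(g) = (g₀₀ − g₁₁)(g₀₀ − g₂₂) − g₁₂ g₂₁` (the torus scales row `0` only). [folklore] -/
theorem blockQuadI_torusRow_mul (u : Fˣ) (h : GL (Fin 3) F) :
    (((diagonalGL (Fin 3) F ![u, 1, 1] * h : GL (Fin 3) F) : Matrix (Fin 3) (Fin 3) F) 0 0 - ((diagonalGL (Fin 3) F ![u, 1, 1] * h : GL (Fin 3) F) : Matrix (Fin 3) (Fin 3) F) 1 1) *
        (((diagonalGL (Fin 3) F ![u, 1, 1] * h : GL (Fin 3) F) : Matrix (Fin 3) (Fin 3) F) 0 0 - ((diagonalGL (Fin 3) F ![u, 1, 1] * h : GL (Fin 3) F) : Matrix (Fin 3) (Fin 3) F) 2 2) -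
      ((diagonalGL (Fin 3) F ![u, 1, 1] * h : GL (Fin 3) F) : Matrix (Fin 3) (Fin 3) F) 1 2 * ((diagonalGL (Fin 3) F ![u, 1, 1] * h : GL (Fin 3) F) : Matrix (Fin 3) (Fin 3) F) 2 1 =
    ((u : F) * (h : Matrix (Fin 3) (Fin 3) F) 0 0) ^ 2 + (-((h : Matrix (Fin 3) (Fin 3) F) 1 1 + (h : Matrix (Fin 3) (Fin 3) F) 2 2)) * ((u : F) * (h : Matrix (Fin 3) (Fin 3) F) 0 0) +
      ((h : Matrix (Fin 3) (Fin 3) F) 1 1 * (h : Matrix (Fin 3) (Fin 3) F) 2 2 - (h : Matrix (Fin 3) (Fin 3) F) 1 2 * (h : Matrix (Fin 3) (Fin 3) F) 2 1) := by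
  simp only [coe_diagonalGL_mul_apply]
  simp
  ring

omit [Valued F ℤᵐ⁰] in
/-- **SHAPE II: `Q_II(diag(1,1,u)·h) = (u h₂₂)² + c (u h₂₂) + e`** with `c = −(h₀₀ + h₁₁)`, `e = h₀₀h₁₁ − h₀₁h₁₀`, where
`Q_II(g) = (g₂₂ − g₀₀)(g₂₂ − g₁₁) − g₀₁ g₁₀` (the torus scales row `2` only). [folklore] -/
theorem blockQuadII_torusRow_mul (u : Fˣ) (h : GL (Fin 3) F) :
    (((diagonalGL (Fin 3) F ![1, 1, u] * h : GL (Fin 3) F) : Matrix (Fin 3) (Fin 3) F) 2 2 - ((diagonalGL (Fin 3) F ![1, 1, u] * h : GL (Fin 3) F) : Matrix (Fin 3) (Fin 3) F) 0 0) *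
        (((diagonalGL (Fin 3) F ![1, 1, u] * h : GL (Fin 3) F) : Matrix (Fin 3) (Fin 3) F) 2 2 - ((diagonalGL (Fin 3) F ![1, 1, u] * h : GL (Fin 3) F) : Matrix (Fin 3) (Fin 3) F) 1 1) -
      ((diagonalGL (Fin 3) F ![1, 1, u] * h : GL (Fin 3) F) : Matrix (Fin 3) (Fin 3) F) 0 1 * ((diagonalGL (Fin 3) F ![1, 1, u] * h : GL (Fin 3) F) : Matrix (Fin 3) (Fin 3) F) 1 0 =
    ((u : F) * (h : Matrix (Fin 3) (Fin 3) F) 2 2) ^ 2 + (-((h : Matrix (Fin 3) (Fin 3) F) 0 0 + (h : Matrix (Fin 3) (Fin 3) F) 1 1)) * ((u : F) * (h : Matrix (Fin 3) (Fin 3) F) 2 2) +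
      ((h : Matrix (Fin 3) (Fin 3) F) 0 0 * (h : Matrix (Fin 3) (Fin 3) F) 1 1 - (h : Matrix (Fin 3) (Fin 3) F) 0 1 * (h : Matrix (Fin 3) (Fin 3) F) 1 0) := by
  simp only [coe_diagonalGL_mul_apply]
  simp
  ring

end Summit.HodgeConjecture.HodgeConjecture.Cruxes.H413.K2E3GL3FinConjBoxes

end
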